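import Summits.QuantumFields.YangMills.Theorems.ColdStartUniversalityLatticeLangevinUniqueErgodic
import Summits.QuantumFields.YangMills.Theorems.ColdStartUniversalityUniformColdStartMixingRungOfHarris
import Literature.MathematicalPhysics.QuantumFieldTheory.ShenZhuZhuErgodicity
import HarnessLib

/-!
# Route `ColdStartUniversality` (fixed-cut-off package): Shen–Zhu–Zhu's «the invariant measure of `(P_t^L)` is unique»
# (Theorem 4.2, "in particular") for `SU(2)`, `d = 3`, at EVERY coupling — BY NAME

Helper file (seat `ym-line-csu-p1`, g13; `--supports stmt-QuantumFields-24809`).  The tree's Literature file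
`ShenZhuZhuErgodicity.lean` types the conclusion shape `SZZUniqueInvariantMeasure r d L β'` of the "in particular" clause of
SZZ Theorem 4.2 («invariant measure of `(P_t^L)_{t≥0}` is unique»): for every family `(U^x)_x` of strong solutions started
at the points `x`, any two probability measures invariant under the transition operators `P_t f(x) = 𝔼 f(U^x_t)` (tested on
bounded measurable `f`) coincide.  SZZ print it under Assumption 1.1 (Bakry–Émery constant `K_𝒮 > 0`, i.e. SMALL `|β|`).

For the structure group `SU(2)` in dimension `d = 3` the fixed-cut-off ergodic package of this route (well-posedness
`latticeLangevinWellPosed_su2`, uniqueness in law `lawUnique_of_start`, THE transition kernels `exists_transitionKernel`,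
Doeblin + Harris `exp_mixing_kernel`, and ★ `eq_wilsonMeasure_of_invariant`: a law invariant under the kernels at all times IS
the Wilson measure) gives the clause at EVERY coupling `β'` — no curvature condition — which is what is landed here:

* `kernelInvariant_of_markovTransition_invariant` — invariance under the transition OPERATORS of any solution family
  (bounded measurable test functions) ⇒ `Kernel.Invariant` under THE transition kernels (test indicators; `law(U^x_t) = κ_t x`);
* `eq_wilsonMeasure_of_markovTransition_invariant` — such a law is the Wilson–Gibbs measure `wilsonMeasure ρ β'`;
* ★ `szzUniqueInvariantMeasure_su2 : SZZUniqueInvariantMeasure (fundamentalLatticeRep 2) 3 L β'` for all `L`, all `β'`.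

THEOREMS ONLY, no definition, no sorry, standard axioms.  HONEST FRAMING: fixed cut-off (nothing uniform in `L` or in the
cut-off); the `W_2`-contraction half of SZZ Theorem 4.2 (`SZZDiracContraction`, Bakry–Émery) is NOT proved here; no crux, rung R3
or summit is proved; the Yang–Mills mass gap is NOT proved.
-/

set_option autoImplicit false

noncomputable section

namespace Summit.QuantumFields.YangMills.Theorems.ColdStartUniversality

open MeasureTheory ProbabilityTheory
open scoped NNReal ENNReal
open Literature.Probability.Process Literature.MathematicalPhysics.QuantumFieldTheory
open Literature.MathematicalPhysics.QuantumLattice (fundamentalRep fundamentalLatticeRep continuous_fundamentalRep)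

variable {L : ℕ} [NeZero L]

/-- **Operator invariance ⇒ kernel invariance.**  If a probability measure `μ` on `SU(2)^E` is invariant under the transition
operators `P_t f(x) = 𝔼 f(U^x_t)` of a family `(U^x)_x` of strong SZZ solutions from the points `x` (tested on bounded measurable
`f`), then `μ` is `Kernel.Invariant` under any Markov kernel family realising the transition laws (`κ_t x = law(U^x_t)`; test the
indicator of a measurable set). [cite: ShenZhuZhu2022, §3 (Markov semigroup P_t^L after Lemma 3.3, p. 13)] [folklore] -/
theorem kernelInvariant_of_markovTransition_invariant (β' : ℝ)
    (κ : ℝ≥0 → Kernel (GaugeConfig 3 L (Matrix.specialUnitaryGroup (Fin 2) ℂ))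
      (GaugeConfig 3 L (Matrix.specialUnitaryGroup (Fin 2) ℂ))) [∀ t, IsMarkovKernel (κ t)]
    (hreal : ∀ (t : ℝ≥0) (x : GaugeConfig 3 L (Matrix.specialUnitaryGroup (Fin 2) ℂ))
        (Ω : Type) [MeasurableSpace Ω] (P : Measure Ω) [IsProbabilityMeasure P]
        (W : ℝ≥0 → Ω → (Edge 3 L × NoiseIdx 2 → ℝ)) (hW : IsFlatBrownian W P)
        (U : ℝ≥0 → Ω → GaugeConfig 3 L (Matrix.specialUnitaryGroup (Fin 2) ℂ)),
        (∀ ω, U 0 ω = x) →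
        (latticeLangevinDynamics (fundamentalLatticeRep 2) β').IsSolution (fundamentalRep (Fin 2))
          hW.natFiltration P W U →
        κ t x = P.map (U t))
    {Ω : Type} [MeasurableSpace Ω] (P : Measure Ω) [IsProbabilityMeasure P]
    (W : ℝ≥0 → Ω → (Edge 3 L × NoiseIdx 2 → ℝ)) (hW : IsFlatBrownian W P)
    (U : GaugeConfig 3 L (Matrix.specialUnitaryGroup (Fin 2) ℂ) → ℝ≥0 → Ω →
      GaugeConfig 3 L (Matrix.specialUnitaryGroup (Fin 2) ℂ))
    (hU : ∀ x, (∀ ω, U x 0 ω = x) ∧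
      (latticeLangevinDynamics (fundamentalLatticeRep 2) β').IsSolution (fundamentalRep (Fin 2))
        hW.natFiltration P W (U x))
    (μ : Measure (GaugeConfig 3 L (Matrix.specialUnitaryGroup (Fin 2) ℂ))) [IsProbabilityMeasure μ]
    (hinv : ∀ f : GaugeConfig 3 L (Matrix.specialUnitaryGroup (Fin 2) ℂ) → ℝ, Measurable f →
      (∃ C : ℝ, ∀ y, |f y| ≤ C) → ∀ t : ℝ≥0, ∫ x, markovTransition U P t f x ∂μ = ∫ x, f x ∂μ)
    (t : ℝ≥0) : Kernel.Invariant (κ t) μ := by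
  classical
  have hmU : ∀ x s, Measurable (U x s) := fun x s =>
    ((hU x).2.adapted s).mono (hW.natFiltration.le s) le_rfl
  -- the kernel at `x` charges `A` with the probability that the solution from `x` is in `A` at time `t`
  have hκA : ∀ (x : GaugeConfig 3 L (Matrix.specialUnitaryGroup (Fin 2) ℂ))
      {A : Set (GaugeConfig 3 L (Matrix.specialUnitaryGroup (Fin 2) ℂ))}, MeasurableSet A →
      κ t x A = P (U x t ⁻¹' A) := by
    intro x A hA
    rw [hreal t x Ω P W hW (U x) (hU x).1 (hU x).2, Measure.map_apply (hmU x t) hA]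
  unfold Kernel.Invariant
  ext A hA
  rw [Measure.bind_apply hA (κ t).measurable.aemeasurable]
  -- operator invariance on the indicator of `A`
  have h1 := hinv (A.indicator fun _ => (1 : ℝ)) (measurable_const.indicator hA)
    ⟨1, fun y => by by_cases hy : y ∈ A <;> simp [hy]⟩ t
  have h2 : ∀ x, markovTransition U P t (A.indicator fun _ => (1 : ℝ)) x = (κ t x A).toReal := by
    intro x
    rw [markovTransition, hκA x hA]
    have hind : (fun ω => A.indicator (fun _ => (1 : ℝ)) (U x t ω)) = (U x t ⁻¹' A).indicator fun _ => (1 : ℝ) := by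
      funext ω
      simp only [Set.indicator, Set.mem_preimage]
    rw [hind, integral_indicator (hmU x t hA), setIntegral_const, smul_eq_mul, mul_one, measureReal_def]
  simp_rw [h2] at h1
  rw [integral_indicator hA, setIntegral_const, smul_eq_mul, mul_one, measureReal_def,
    integral_toReal ((κ t).measurable_coe hA).aemeasurable
      (Filter.Eventually.of_forall fun x => (measure_lt_top (κ t x) A))] at h1
  have hne : ∫⁻ x, κ t x A ∂μ ≠ ∞ := by
    refine ne_top_of_le_ne_top (measure_ne_top μ Set.univ) ?_
    calc ∫⁻ x, κ t x A ∂μ ≤ ∫⁻ _x, 1 ∂μ := lintegral_mono fun x => prob_le_one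
      _ = _ := by rw [lintegral_const, one_mul]
  exact (ENNReal.toReal_eq_toReal_iff' hne (measure_ne_top _ A)).1 h1

/-- **A law invariant under the transition operators of an SU(2) SZZ solution family is the Wilson–Gibbs measure**, at every
coupling `β'` (operator invariance ⇒ invariance under THE transition kernels `exists_transitionKernel` ⇒
`eq_wilsonMeasure_of_invariant`). [cite: ShenZhuZhuCMP2023, Theorem 4.2] [folklore] -/
theorem eq_wilsonMeasure_of_markovTransition_invariant (β' : ℝ)
    {Ω : Type} [MeasurableSpace Ω] (P : Measure Ω) [IsProbabilityMeasure P]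
    (W : ℝ≥0 → Ω → (Edge 3 L × NoiseIdx 2 → ℝ)) (hW : IsFlatBrownian W P)
    (U : GaugeConfig 3 L (Matrix.specialUnitaryGroup (Fin 2) ℂ) → ℝ≥0 → Ω →
      GaugeConfig 3 L (Matrix.specialUnitaryGroup (Fin 2) ℂ))
    (hU : ∀ x, (∀ ω, U x 0 ω = x) ∧
      (latticeLangevinDynamics (fundamentalLatticeRep 2) β').IsSolution (fundamentalRep (Fin 2))
        hW.natFiltration P W (U x))
    (μ : Measure (GaugeConfig 3 L (Matrix.specialUnitaryGroup (Fin 2) ℂ))) [IsProbabilityMeasure μ]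
    (hinv : ∀ f : GaugeConfig 3 L (Matrix.specialUnitaryGroup (Fin 2) ℂ) → ℝ, Measurable f →
      (∃ C : ℝ, ∀ y, |f y| ≤ C) → ∀ t : ℝ≥0, ∫ x, markovTransition U P t f x ∂μ = ∫ x, f x ∂μ) :
    μ = wilsonMeasure (d := 3) (L := L) (fundamentalRep (Fin 2)) β' := by
  obtain ⟨κ, hκ, -, hreal⟩ := exists_transitionKernel L β'
  exact eq_wilsonMeasure_of_invariant β' κ hreal μ
    (kernelInvariant_of_markovTransition_invariant β' κ hreal P W hW U hU μ hinv)

/-- ★ **Shen–Zhu–Zhu, Theorem 4.2 ("in particular, invariant measure of `(P_t^L)_{t≥0}` is unique") for `SU(2)`, `d = 3`,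
at EVERY coupling**: the Literature conclusion shape `SZZUniqueInvariantMeasure (fundamentalLatticeRep 2) 3 L β'` holds for
every torus size `L` and every `β'` — any two probability measures invariant under the transition operators of a family of
strong solutions from all points coincide (both are the Wilson–Gibbs measure).  SZZ print it for small `|β|` via Bakry–Émery;
here it comes from the fixed-cut-off Doeblin–Harris package of the route (no curvature condition; constants not uniform in
`L`). [cite: ShenZhuZhuCMP2023, Theorem 4.2] -/
theorem szzUniqueInvariantMeasure_su2 (L : ℕ) [NeZero L] (β' : ℝ) :
    SZZUniqueInvariantMeasure (fundamentalLatticeRep 2) 3 L β' := by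
  intro Ω _ P _ W hW U hU μ ν hμ hν hμinv hνinv
  rw [eq_wilsonMeasure_of_markovTransition_invariant β' P W hW U hU μ hμinv,
    eq_wilsonMeasure_of_markovTransition_invariant β' P W hW U hU ν hνinv]

end Summit.QuantumFields.YangMills.Theorems.ColdStartUniversality

end
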